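import Literature.NumberTheory.EllipticCurves.PeriodIndexObstructionLocal
import Literature.NumberTheory.EllipticCurves.VariableChangePointsMap
import HarnessLib

/-!
# The period–index obstruction, III: base change along `K̄ → K̄_E`, local triviality, and
Cassels' theorem from the Hasse principle

`Proofs`-style file (theorems only; no definitions, no named facts) under the provefact seat on
`Literature.NumberTheory.EllipticCurves.Cassels1962_index_eq_period_of_mem_sha`, completing the
formalization of the printed proof (Clark 2006, Prop. 6, second proof; Clark–Sharif §2 (3)) up
to its class-field-theoretic input. `PeriodIndexObstruction` reduced Cassels' `I = P` on `Ш` to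
the vanishing of the obstruction `2`-cocycle `e` of Selmer classes; `PeriodIndexObstructionLocal`
proved that `e` is continuous and that it is a coboundary for a *split* torsor. Here:

1. **Base change of the divisor calculus along a `K`-embedding `ι : K̄ → K̄_E`** (`E/K` any
   field, typically a completion): the point map `θ = ι_* : E(K̄) → E_E(K̄_E)` (the tree's
   `pointsMapOfEmb` followed by the transport `(W_E)_{K̄_E} = W_{K̄_E}`,
   `baseChange_baseChange_algebraicClosure`; `theta_smul`: equivariant along `Γ_E → Γ_K`), the
   ring homomorphism `φ = ι_* : K̄(E) → K̄_E(E_E)` (`exists_ringHom_geomFunctionField_baseChange`,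
   via `WeierstrassFunctionField.funcAlgHom`; unique by `ringHom_ext_of_genX_genY`) and its
   compatibilities: with the Galois actions (`map_galFunctionField_resGalOfEmb`), with
   translations (`map_transAlgHom`, by the generic-point computation of `FunctionFieldTranslation`),
   hence with the twisted actions (`map_twistGal`); with the coordinate rings
   (`exists_ringHom_coordinateRing_baseChange`, `map_algebraMap_coordinateRing`); and **with
   divisors**: `ord_{θP}(ι_* u) = ord_P(u)` and `ord_R(ι_* u) = 0` off `θ(E(K̄))` (`ord_map`,
   `ord_map_eq_mapDomain`) — by the degree argument (`ord_map_algebraMap`): both divisors have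
   degree `0` (`finsum_ord`), the order at `O` is the degree of the norm, unchanged
   (`normDeg_map`, Mathlib's `degree_norm_smul_basis`), orders at affine points cannot drop
   (`ord_le_ord_map_algebraMap_some`: `r ∈ 𝔪_P^m ⇒ ι_* r ∈ 𝔪_{θP}^m`, adic valuations) and
   `ι_* r` is regular elsewhere.
2. `obstruction_cocycle` — `e` is a `2`-cocycle: `e(σ,τ) e(στ,υ) = σ(e(τ,υ)) e(σ,τυ)`.
3. **Local triviality** (`exists_local_coboundary_of_mem_localRestrictionKerOfEmb`,
   `exists_local_coboundary_of_mem_localRestrictionKer`): if the class of `c` dies in `H¹(E, E)`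
   (`WeierstrassCurve.localRestrictionKer`), then `ι ∘ e ∘ (res × res)` is the coboundary of a
   locally constant `b : Γ_E → K̄_E^×` — transport the data along `ι_*` and apply the split case
   over the base field `E`. ("`V(K_v) ≠ ∅` implies `δ ≡ 0`", Clark 2006, Prop. 6; O'Neil's b).)
4. **`Cassels1962_index_eq_period_of_mem_sha_of_hassePrinciple`**: Cassels' theorem follows from
   the Hasse principle for `H²(K, K̄^×)` in cochain form (a locally constant `2`-cocycle of `Γ_K`
   in `K̄^×` which is a continuous coboundary at every finite and infinite place is a continuous
   coboundary: Albert–Brauer–Hasse–Noether, `Br(K) ↪ ⊕_v Br(K_v)`), the one remaining input —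
   global class field theory, not in Mathlib or the tree — spelled out as a hypothesis (D-0026).

## References

* P. L. Clark, *There are genus one curves of every index over every number field*, J. reine
  angew. Math. 594 (2006) 201–206, Prop. 6 (both proofs), Prop. 5(a); arXiv:math/0411413 read.
  [Clark2006Crelle]
* P. L. Clark, S. Sharif, *Period, index and potential Ш*, Algebra & Number Theory 4 (2010)
  151–174, §1.3, §2 eq. (3), §3.7 (ii); arXiv:0811.3019 read. [ClarkSharif2010]
* J. W. S. Cassels, *Arithmetic on curves of genus 1. IV. Proof of the Hauptvermutung*, J. reine
  angew. Math. 211 (1962) 95–112 (the theorem, as reported by the two sources above).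
* D. Harari, *Galois Cohomology and Class Field Theory*, Thm. 14.11 (Brauer–Hasse–Noether).
* J. H. Silverman, *The Arithmetic of Elliptic Curves*, 2nd ed., GTM 106: II.§1–2, III.3.6,
  X.4.2(a). [SilvermanAEC2009]

## Design

No definitions: `θ`, `φ`, `φc` are universally quantified homomorphisms pinned down by their
defining properties (`hθ`, `hφ₀ hφx hφy`, `hφc`), with existence theorems; statements about the
twisted action and divisors are written out as in the two previous files.
-/

noncomputable section

open scoped Classical
open scoped Polynomial.Bivariate

universe u

namespace Literature.NumberTheory.EllipticCurves

open GaloisRepresentations WeierstrassCurve WeierstrassFunctionField Polynomial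

variable {K : Type u} [Field K] (W : WeierstrassCurve K) {E : Type u} [Field E] [Algebra K E]

/-! ### The curve over `K̄_E` and the transport of points -/

section Points

/-- `(W_E)_{K̄_E} = W_{K̄_E}`: base change to `E` and then to `K̄_E` is base change to `K̄_E`.
[folklore] -/
theorem baseChange_baseChange_algebraicClosure :
    (W.baseChange E).baseChange (AlgebraicClosure E) = W.baseChange (AlgebraicClosure E) :=
  W.map_baseChange (Algebra.ofId E (AlgebraicClosure E))

/-- The transport `E(K̄_E) = W_{K̄_E}(K̄_E) → (W_E)_{K̄_E}(K̄_E)` along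
`baseChange_baseChange_algebraicClosure` (the identity on coordinates) carries the action of
`σ ∈ Γ_E` through `Aut_K(K̄_E)` (file `Sha`) to the coordinatewise action `Point.map σ`.
Silverman, *AEC*, VIII.§1. [folklore] -/
theorem congrEquiv_symm_smul (σ : Field.absoluteGaloisGroup E) (R : localPoints W E) :
    Affine.Point.congrEquiv (baseChange_baseChange_algebraicClosure W (E := E)).symm (σ • R) =
      Affine.Point.map (show AlgebraicClosure E ≃ₐ[E] AlgebraicClosure E from σ :
          AlgebraicClosure E →ₐ[E] AlgebraicClosure E)
        (Affine.Point.congrEquiv (baseChange_baseChange_algebraicClosure W (E := E)).symm R) := by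
  rw [localPoints.smul_def]
  change Affine.Point.congrEquiv _ (Affine.Point.map _ R) = _
  rcases R with _ | ⟨x, y, hxy⟩
  · show Affine.Point.congrEquiv _ 0 = Affine.Point.map _ (Affine.Point.congrEquiv _ 0)
    rw [Affine.Point.congrEquiv_zero]
    rfl
  · rw [Affine.Point.map_some, Affine.Point.congrEquiv_some, Affine.Point.congrEquiv_some,
      Affine.Point.map_some]
    rfl

variable (ι : AlgebraicClosure K →ₐ[K] AlgebraicClosure E)
variable (θ : WeierstrassCurve.geomPoints W →+ WeierstrassCurve.geomPoints (W.baseChange E))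
variable (hθ : ∀ P, θ P = Affine.Point.congrEquiv
  (baseChange_baseChange_algebraicClosure W (E := E)).symm (pointsMapOfEmb W ι P))

include hθ

/-- The point map `θ = ι_* : E(K̄) → E_E(K̄_E)` on coordinates: `θ (a, b) = (ι a, ι b)`. [folklore] -/
theorem theta_some {a b : AlgebraicClosure K}
    (h : (W.baseChange (AlgebraicClosure K)).toAffine.Nonsingular a b) :
    ∃ h', θ (.some a b h) = .some (ι a) (ι b) h' := by
  have h1 : θ (.some a b h) = Affine.Point.congrEquiv
      (baseChange_baseChange_algebraicClosure W (E := E)).symm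
      (Affine.Point.map ι (Affine.Point.some a b h)) := hθ _
  rw [Affine.Point.map_some, Affine.Point.congrEquiv_some] at h1
  exact ⟨_, h1⟩

/-- `θ` is injective (`ι` is). [folklore] -/
theorem theta_injective : Function.Injective θ := by
  intro P Q hPQ
  rw [hθ, hθ] at hPQ
  exact pointsMapOfEmb_injective W ι ((Affine.Point.congrEquiv _).injective hPQ)

/-- **`θ` is equivariant along `Γ_E → Γ_K`**: `θ (σ|_{K̄} P) = σ (θ P)` (`pointsMapOfEmb_smul`,
and the transport `E(K̄_E) → E_E(K̄_E)`, the identity on coordinates, intertwines the action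
through `Aut_K(K̄_E)` with the coordinatewise one). Silverman, *AEC*, VIII.§1. [folklore] -/
theorem theta_smul (σ : Field.absoluteGaloisGroup E) (P : WeierstrassCurve.geomPoints W) :
    θ (resGalOfEmb ι σ • P) = σ • θ P := by
  rw [hθ, hθ, pointsMapOfEmb_smul, congrEquiv_symm_smul]
  rfl

end Points

/-! ### The equation over `K̄_E` is the image of the equation over `K̄` -/

section Equation

variable (ι : AlgebraicClosure K →ₐ[K] AlgebraicClosure E)

/-- The Weierstrass polynomial of `(W_E)_{K̄_E}` is the image under `ι` of that of `W_{K̄}`.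
[folklore] -/
theorem polynomial_baseChange_eq_map :
    ((W.baseChange E).baseChange (AlgebraicClosure E)).toAffine.polynomial =
      (W.baseChange (AlgebraicClosure K)).toAffine.polynomial.map
        (mapRingHom (ι : AlgebraicClosure K →+* AlgebraicClosure E)) := by
  rw [← Affine.map_polynomial, baseChange_baseChange_algebraicClosure]
  change _ = ((W.baseChange (AlgebraicClosure K)).map
    (ι : AlgebraicClosure K →+* AlgebraicClosure E)).toAffine.polynomial
  rw [W.map_baseChange ι]

end Equation

/-! ### The base-change map `φ = ι_* : K̄(E) → K̄_E(E_E)` of function fields -/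

section FunctionField

variable (ι : AlgebraicClosure K →ₐ[K] AlgebraicClosure E)

/-- **Ring homomorphisms out of `K̄(E)` are determined by their values on the constants and on
the generic coordinates `x, y`** (`K̄(E)` is the fraction field of `K̄[x, y]/(W)`). [folklore] -/
theorem ringHom_ext_of_genX_genY {L : Type*} [CommRing L] {f g : W.geomFunctionField →+* L}
    (h0 : ∀ a : AlgebraicClosure K, f (algebraMap (AlgebraicClosure K) W.geomFunctionField a) =
      g (algebraMap (AlgebraicClosure K) W.geomFunctionField a))
    (hx : f W.genX = g W.genX) (hy : f W.genY = g W.genY) : f = g := by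
  refine IsLocalization.ringHom_ext (nonZeroDivisors W.geomCoordRing) ?_
  refine Ideal.Quotient.ringHom_ext (Polynomial.ringHom_ext' (Polynomial.ringHom_ext' ?_ ?_) ?_)
  · refine RingHom.ext fun a ↦ ?_
    exact h0 a
  · exact hx
  · exact hy

/-- **The base-change homomorphism `ι_* : K̄(E) → K̄_E(E_E)` exists**: a ring homomorphism
extending `ι` on constants and mapping the generic coordinates `x, y` of `E/K̄` to those of
`E_E/K̄_E` (the `K̄`-algebra map of the point `(x, y) ∈ E(K̄_E(E_E))`, `x` being transcendental
over `K̄`; `WeierstrassFunctionField.funcAlgHom`). It is the inclusion `K̄(E) ⊆ K̄_E(E)` of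
Silverman, *AEC*, II.§2 (`K̄(C) ⊗ ...`), and it is unique by `ringHom_ext_of_genX_genY`.
[folklore] -/
theorem exists_ringHom_geomFunctionField_baseChange [W.IsElliptic] :
    ∃ φ : W.geomFunctionField →+* (W.baseChange E).geomFunctionField,
      (∀ a : AlgebraicClosure K, φ (algebraMap (AlgebraicClosure K) W.geomFunctionField a) =
        algebraMap (AlgebraicClosure E) (W.baseChange E).geomFunctionField (ι a)) ∧
      φ W.genX = (W.baseChange E).genX ∧ φ W.genY = (W.baseChange E).genY := by
  letI : Algebra (AlgebraicClosure K) (AlgebraicClosure E) := (ι : AlgebraicClosure K →+* _).toAlgebra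
  have hιa : ∀ a, algebraMap (AlgebraicClosure K) (AlgebraicClosure E) a = ι a := fun _ ↦ rfl
  have htower : algebraMap (AlgebraicClosure K) (W.baseChange E).geomFunctionField =
      (algebraMap (AlgebraicClosure E) (W.baseChange E).geomFunctionField).comp
        (ι : AlgebraicClosure K →+* AlgebraicClosure E) :=
    IsScalarTower.algebraMap_eq (AlgebraicClosure K) (AlgebraicClosure E) _
  have hpoly := polynomial_baseChange_eq_map W (E := E) ι
  have heq : ((W.baseChange (AlgebraicClosure K)).toAffine.polynomial.map
      (mapRingHom (algebraMap (AlgebraicClosure K) (W.baseChange E).geomFunctionField))).evalEval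
        (W.baseChange E).genX (W.baseChange E).genY = 0 := by
    have h := evalEval_xF_yF ((W.baseChange E).baseChange (AlgebraicClosure E)).toAffine
    rw [htower, ← Polynomial.mapRingHom_comp, ← Polynomial.map_map, ← hpoly]
    exact h
  have htr : Transcendental (AlgebraicClosure K) (W.baseChange E).genX := fun halg ↦
    transcendental_xF ((W.baseChange E).baseChange (AlgebraicClosure E)).toAffine
      (halg.tower_top (AlgebraicClosure E))
  refine ⟨(funcAlgHom _ _ heq htr).toRingHom, fun a ↦ ?_, ?_, ?_⟩
  · change funcAlgHom _ _ heq htr (algebraMap (AlgebraicClosure K) W.geomFunctionField a) = _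
    rw [(funcAlgHom _ _ heq htr).commutes a, htower]
    rfl
  · exact funcAlgHom_xF _ _ heq htr
  · exact funcAlgHom_yF _ _ heq htr

variable (φ : W.geomFunctionField →+* (W.baseChange E).geomFunctionField)
variable (hφ₀ : ∀ a : AlgebraicClosure K, φ (algebraMap (AlgebraicClosure K) W.geomFunctionField a) =
  algebraMap (AlgebraicClosure E) (W.baseChange E).geomFunctionField (ι a))
variable (hφx : φ W.genX = (W.baseChange E).genX) (hφy : φ W.genY = (W.baseChange E).genY)

include hφ₀ hφx hφy

/-- **`ι_*` is compatible with the Galois actions**: `ι_* ∘ (σ|_{K̄})~ = σ̃ ∘ ι_*` for `σ ∈ Γ_E`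
(both sides are ring homomorphisms out of `K̄(E)` agreeing on constants — `ι (σ|_{K̄} a) =
σ (ι a)` — and fixing `x, y`). Silverman, *AEC*, II.§2 (`(f^σ)` and base extension). [folklore] -/
theorem map_galFunctionField_resGalOfEmb (σ : Field.absoluteGaloisGroup E) (u : W.geomFunctionField) :
    φ (W.galFunctionField (resGalOfEmb ι σ) u) =
      (W.baseChange E).galFunctionField σ (φ u) := by
  have h : φ.comp (W.galFunctionField (resGalOfEmb ι σ)).toRingHom =
      ((W.baseChange E).galFunctionField σ).toRingHom.comp φ := by
    refine ringHom_ext_of_genX_genY W (fun a ↦ ?_) ?_ ?_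
    · change φ (W.galFunctionField (resGalOfEmb ι σ) _) =
        (W.baseChange E).galFunctionField σ (φ _)
      rw [galFunctionField_algebraMap_base, hφ₀, hφ₀, galFunctionField_algebraMap_base,
        galRingHom_apply, galRingHom_apply]
      congr 1
      exact apply_resGalAuxOfEmb_apply ι σ a
    · change φ (W.galFunctionField (resGalOfEmb ι σ) W.genX) =
        (W.baseChange E).galFunctionField σ (φ W.genX)
      rw [galFunctionField_genX, hφx, galFunctionField_genX]
    · change φ (W.galFunctionField (resGalOfEmb ι σ) W.genY) =
        (W.baseChange E).galFunctionField σ (φ W.genY)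
      rw [galFunctionField_genY, hφy, galFunctionField_genY]
  exact RingHom.congr_fun h u

end FunctionField

/-! ### `ι_*` and translations -/

section Translation

variable (ι : AlgebraicClosure K →ₐ[K] AlgebraicClosure E) [W.IsElliptic]
variable (θ : WeierstrassCurve.geomPoints W →+ WeierstrassCurve.geomPoints (W.baseChange E))
variable (hθ : ∀ P, θ P = Affine.Point.congrEquiv
  (baseChange_baseChange_algebraicClosure W (E := E)).symm (pointsMapOfEmb W ι P))
variable (φ : W.geomFunctionField →+* (W.baseChange E).geomFunctionField)
variable (hφ₀ : ∀ a : AlgebraicClosure K, φ (algebraMap (AlgebraicClosure K) W.geomFunctionField a) =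
  algebraMap (AlgebraicClosure E) (W.baseChange E).geomFunctionField (ι a))
variable (hφx : φ W.genX = (W.baseChange E).genX) (hφy : φ W.genY = (W.baseChange E).genY)

include hθ hφ₀ hφx hφy

/-- **`ι_*` is compatible with translations**: `ι_* ∘ τ_T^* = τ_{ι T}^* ∘ ι_*`. Both sides are
ring homomorphisms out of `K̄(E)` agreeing on constants; on the generic point `(x, y)` the left
side gives `ι_*((x, y) + T) = (x, y) + ι T` (`Affine.Point.map` along `ι_*` is additive and maps
constant points to constant points) and so does the right side (`map_transAlgHom_genericPoint`
over `K̄_E`). Silverman, *AEC*, III.3.6, II.§2. [folklore] -/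
theorem map_transAlgHom (T : WeierstrassCurve.geomPoints W) (u : W.geomFunctionField) :
    φ (W.transAlgHom T u) = (W.baseChange E).transAlgHom (θ T) (φ u) := by
  -- `φ` is `K`-linear
  have hφK : ∀ k : K, φ (algebraMap K W.geomFunctionField k) =
      algebraMap K (W.baseChange E).geomFunctionField k := fun k ↦ by
    rw [IsScalarTower.algebraMap_apply K (AlgebraicClosure K) W.geomFunctionField, hφ₀,
      AlgHom.commutes, ← IsScalarTower.algebraMap_apply]
  let φₐ : W.geomFunctionField →ₐ[K] (W.baseChange E).geomFunctionField :=
    { φ with commutes' := hφK }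
  have hF : (W.baseChange E).baseChange (W.baseChange E).geomFunctionField =
      W.baseChange (W.baseChange E).geomFunctionField :=
    W.map_baseChange (Algebra.ofId E (W.baseChange E).geomFunctionField)
  -- images of the generic point and of the constant point `T` under `φ`
  have hgen : Affine.Point.map (W' := W) φₐ W.genericPoint =
      Affine.Point.congrEquiv hF (W.baseChange E).genericPoint := by
    rw [WeierstrassCurve.genericPoint, WeierstrassCurve.genericPoint, Affine.Point.map_some,
      Affine.Point.congrEquiv_some, Affine.Point.some.injEq]
    exact ⟨hφx, hφy⟩
  have hconst : Affine.Point.map (W' := W) φₐ (W.constPoint T) =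
      Affine.Point.congrEquiv hF ((W.baseChange E).constPoint (θ T)) := by
    rcases eq_or_ne T 0 with rfl | hT
    · rw [map_zero, map_zero, map_zero, map_zero, Affine.Point.congrEquiv_zero]
    · obtain ⟨a, b, hab, rfl⟩ := geomPoints.exists_eq_some hT
      obtain ⟨h', hθT⟩ := theta_some W ι θ hθ hab
      rw [constPoint_some, Affine.Point.map_some, hθT, constPoint_some, Affine.Point.congrEquiv_some,
        Affine.Point.some.injEq]
      exact ⟨hφ₀ a, hφ₀ b⟩
  -- the generic point under both composites
  have h2 := congrArg (Affine.Point.map (W' := W) φₐ) (map_transAlgHom_genericPoint (W := W) T)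
  rw [map_add, hgen, hconst, ← map_add,
    ← map_transAlgHom_genericPoint (W := W.baseChange E) (θ T)] at h2
  rw [WeierstrassCurve.genericPoint, WeierstrassCurve.genericPoint, Affine.Point.map_some,
    Affine.Point.map_some, Affine.Point.map_some, Affine.Point.congrEquiv_some,
    Affine.Point.some.injEq] at h2
  obtain ⟨hx', hy'⟩ := h2
  have h : φ.comp (W.transAlgHom T).toRingHom =
      ((W.baseChange E).transAlgHom (θ T)).toRingHom.comp φ := by
    refine ringHom_ext_of_genX_genY W (fun a ↦ ?_) ?_ ?_
    · change φ (W.transAlgHom T (algebraMap _ _ a)) =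
        (W.baseChange E).transAlgHom (θ T) (φ (algebraMap _ _ a))
      rw [AlgHom.commutes, hφ₀, AlgHom.commutes]
    · change φ (W.transAlgHom T W.genX) = (W.baseChange E).transAlgHom (θ T) (φ W.genX)
      rw [hφx]
      exact hx'
    · change φ (W.transAlgHom T W.genY) = (W.baseChange E).transAlgHom (θ T) (φ W.genY)
      rw [hφy]
      exact hy'
  exact RingHom.congr_fun h u

variable (c : contOneCocycles (discreteTopRep (Field.absoluteGaloisGroup K) (WeierstrassCurve.geomPoints W)))

/-- **`ι_*` intertwines the twisted actions**: for the pulled-back cocycle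
`c_E(σ) = θ(c(σ|_{K̄}))` on `E_E(K̄_E)`, `ι_* (ρ_{σ|K̄} u) = ρ'_σ (ι_* u)` where
`ρ_σ = τ_{-c(σ)}^* ∘ σ̃` and `ρ'_σ = τ_{-c_E(σ)}^* ∘ σ̃` (`map_galFunctionField_resGalOfEmb`,
`map_transAlgHom`). [folklore] -/
theorem map_twistGal (σ : Field.absoluteGaloisGroup E) (u : W.geomFunctionField) :
    φ (W.transAlgHom (-(c.1 (resGalOfEmb ι σ))) (W.galFunctionField (resGalOfEmb ι σ) u)) =
      (W.baseChange E).transAlgHom (-(θ (c.1 (resGalOfEmb ι σ))))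
        ((W.baseChange E).galFunctionField σ (φ u)) := by
  rw [map_transAlgHom W ι θ hθ φ hφ₀ hφx hφy, map_neg,
    map_galFunctionField_resGalOfEmb W ι φ hφ₀ hφx hφy]

end Translation

/-! ### `ι_*` on regular functions: the coordinate rings -/

section CoordinateRing

variable (ι : AlgebraicClosure K →ₐ[K] AlgebraicClosure E)

/-- **The base-change map on coordinate rings `K̄[E] → K̄_E[E_E]`** (coefficientwise `ι`; the
Weierstrass polynomial of `E_E/K̄_E` is the image of that of `E/K̄`,
`polynomial_baseChange_eq_map`). [folklore] -/
theorem exists_ringHom_coordinateRing_baseChange :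
    ∃ φc : (W.baseChange (AlgebraicClosure K)).toAffine.CoordinateRing →+*
        ((W.baseChange E).baseChange (AlgebraicClosure E)).toAffine.CoordinateRing,
      ∀ p : (AlgebraicClosure K)[X][Y], φc (AdjoinRoot.mk _ p) =
        AdjoinRoot.mk _ (p.map (mapRingHom (ι : AlgebraicClosure K →+* AlgebraicClosure E))) := by
  have hpoly := polynomial_baseChange_eq_map W (E := E) ι
  refine ⟨Ideal.quotientMap _
    (mapRingHom (mapRingHom (ι : AlgebraicClosure K →+* AlgebraicClosure E))) ?_, fun p ↦ ?_⟩
  · rw [Ideal.span_singleton_le_iff_mem, Ideal.mem_comap, coe_mapRingHom, ← hpoly]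
    exact Ideal.mem_span_singleton_self _
  · exact Ideal.quotientMap_mk

variable (φc : (W.baseChange (AlgebraicClosure K)).toAffine.CoordinateRing →+*
  ((W.baseChange E).baseChange (AlgebraicClosure E)).toAffine.CoordinateRing)
variable (hφc : ∀ p : (AlgebraicClosure K)[X][Y], φc (AdjoinRoot.mk _ p) =
  AdjoinRoot.mk _ (p.map (mapRingHom (ι : AlgebraicClosure K →+* AlgebraicClosure E))))

include hφc

/-- `φc (X - a) = X - ι a`. [folklore] -/
theorem map_XClass (a : AlgebraicClosure K) :
    φc (Affine.CoordinateRing.XClass _ a) = Affine.CoordinateRing.XClass _ (ι a) := by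
  rw [Affine.CoordinateRing.XClass, Affine.CoordinateRing.XClass]
  change φc (AdjoinRoot.mk _ _) = AdjoinRoot.mk _ _
  rw [hφc, Polynomial.map_C, coe_mapRingHom, Polynomial.map_sub, Polynomial.map_X, Polynomial.map_C]
  rfl

/-- `φc (Y - b) = Y - ι b`. [folklore] -/
theorem map_YClass (b : AlgebraicClosure K) :
    φc (Affine.CoordinateRing.YClass _ (C b)) = Affine.CoordinateRing.YClass _ (C (ι b)) := by
  rw [Affine.CoordinateRing.YClass, Affine.CoordinateRing.YClass]
  change φc (AdjoinRoot.mk _ _) = AdjoinRoot.mk _ _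
  rw [hφc, Polynomial.map_sub, Polynomial.map_X, Polynomial.map_C, coe_mapRingHom, Polynomial.map_C]
  rfl

/-- `φc` maps the ideal of the point `(a, b)` into the ideal of `(ι a, ι b)`. [folklore] -/
theorem map_pointIdeal_le (a b : AlgebraicClosure K) :
    Ideal.map φc (pointIdeal (W.baseChange (AlgebraicClosure K)).toAffine a b) ≤
      pointIdeal ((W.baseChange E).baseChange (AlgebraicClosure E)).toAffine (ι a) (ι b) := by
  rw [Ideal.map_le_iff_le_comap]
  change Ideal.span _ ≤ _
  rw [Ideal.span_le, Set.insert_subset_iff, Set.singleton_subset_iff, SetLike.mem_coe,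
    SetLike.mem_coe, Ideal.mem_comap, Ideal.mem_comap, map_XClass W ι φc hφc,
    map_YClass W ι φc hφc]
  exact ⟨Ideal.subset_span (by simp), Ideal.subset_span (by simp)⟩

/-- `φc (p • 1 + q • y) = ι(p) • 1 + ι(q) • y` on the `K̄[X]`-basis `{1, y}`. [folklore] -/
theorem map_smul_basis (p q : (AlgebraicClosure K)[X]) :
    φc (p • (1 : (W.baseChange (AlgebraicClosure K)).toAffine.CoordinateRing) +
        q • Affine.CoordinateRing.mk _ Y) =
      p.map (ι : AlgebraicClosure K →+* AlgebraicClosure E) •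
          (1 : ((W.baseChange E).baseChange (AlgebraicClosure E)).toAffine.CoordinateRing) +
        q.map (ι : AlgebraicClosure K →+* AlgebraicClosure E) • Affine.CoordinateRing.mk _ Y := by
  rw [map_add, Affine.CoordinateRing.smul, Affine.CoordinateRing.smul, Affine.CoordinateRing.smul,
    Affine.CoordinateRing.smul, map_mul, map_mul, map_one]
  change φc (AdjoinRoot.mk _ _) * 1 + φc (AdjoinRoot.mk _ _) * φc (AdjoinRoot.mk _ _) = _
  rw [hφc, hφc, hφc, Polynomial.map_C, Polynomial.map_C, Polynomial.map_X]
  rfl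

/-- **`φc` preserves the degree of the norm** (`N(ι r) = ι N(r)`): the order of the pole at
infinity is unchanged. [folklore] -/
theorem normDeg_map (r : (W.baseChange (AlgebraicClosure K)).toAffine.CoordinateRing) :
    normDeg ((W.baseChange E).baseChange (AlgebraicClosure E)).toAffine (φc r) =
      normDeg (W.baseChange (AlgebraicClosure K)).toAffine r := by
  obtain ⟨p, q, rfl⟩ := Affine.CoordinateRing.exists_smul_basis_eq r
  rw [map_smul_basis W ι φc hφc, normDeg, normDeg]
  apply natDegree_eq_of_degree_eq
  rw [Affine.CoordinateRing.degree_norm_smul_basis, Affine.CoordinateRing.degree_norm_smul_basis,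
    degree_map, degree_map]

variable [W.IsElliptic]
variable (φ : W.geomFunctionField →+* (W.baseChange E).geomFunctionField)
variable (hφ₀ : ∀ a : AlgebraicClosure K, φ (algebraMap (AlgebraicClosure K) W.geomFunctionField a) =
  algebraMap (AlgebraicClosure E) (W.baseChange E).geomFunctionField (ι a))
variable (hφx : φ W.genX = (W.baseChange E).genX) (hφy : φ W.genY = (W.baseChange E).genY)

include hφ₀ hφx hφy

omit [W.IsElliptic] in
/-- **`ι_*` restricts to the coordinate rings**: `ι_* (r) = φc r` for `r ∈ K̄[E]` (both are
ring homomorphisms out of `K̄[E] = K̄[X][Y]/(W)` agreeing on constants, `x` and `y`). [folklore] -/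
theorem map_algebraMap_coordinateRing (r : (W.baseChange (AlgebraicClosure K)).toAffine.CoordinateRing) :
    φ (algebraMap _ W.geomFunctionField r) =
      algebraMap _ (W.baseChange E).geomFunctionField (φc r) := by
  have hconst : ∀ a : AlgebraicClosure K,
      algebraMap (W.baseChange (AlgebraicClosure K)).toAffine.CoordinateRing W.geomFunctionField
        (AdjoinRoot.mk _ (C (C a))) = algebraMap (AlgebraicClosure K) W.geomFunctionField a := fun a ↦ by
    rw [IsScalarTower.algebraMap_apply (AlgebraicClosure K)
      (W.baseChange (AlgebraicClosure K)).toAffine.CoordinateRing W.geomFunctionField]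
    rfl
  have hconst' : ∀ a : AlgebraicClosure E,
      algebraMap ((W.baseChange E).baseChange (AlgebraicClosure E)).toAffine.CoordinateRing
        (W.baseChange E).geomFunctionField (AdjoinRoot.mk _ (C (C a))) =
          algebraMap (AlgebraicClosure E) (W.baseChange E).geomFunctionField a := fun a ↦ by
    rw [IsScalarTower.algebraMap_apply (AlgebraicClosure E)
      ((W.baseChange E).baseChange (AlgebraicClosure E)).toAffine.CoordinateRing
      (W.baseChange E).geomFunctionField]
    rfl
  have h : φ.comp (algebraMap (W.baseChange (AlgebraicClosure K)).toAffine.CoordinateRing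
      W.geomFunctionField) = (algebraMap _ (W.baseChange E).geomFunctionField).comp φc := by
    refine Ideal.Quotient.ringHom_ext (Polynomial.ringHom_ext' (Polynomial.ringHom_ext' ?_ ?_) ?_)
    · refine RingHom.ext fun a ↦ ?_
      simp only [RingHom.comp_apply]
      change φ (algebraMap _ W.geomFunctionField (AdjoinRoot.mk _ (C (C a)))) =
        algebraMap _ (W.baseChange E).geomFunctionField (φc (AdjoinRoot.mk _ (C (C a))))
      rw [hconst, hφ₀, hφc, Polynomial.map_C, coe_mapRingHom, Polynomial.map_C, hconst']
      rfl
    · change φ W.genX = algebraMap _ (W.baseChange E).geomFunctionField (φc (AdjoinRoot.mk _ (C X)))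
      rw [hφx, hφc, Polynomial.map_C, coe_mapRingHom, Polynomial.map_X]
      rfl
    · change φ W.genY = algebraMap _ (W.baseChange E).geomFunctionField (φc (AdjoinRoot.mk _ Y))
      rw [hφy, hφc, Polynomial.map_X]
      rfl
  exact RingHom.congr_fun h r

omit [W.IsElliptic] in
/-- `φc` is injective (`ι_*` is, being a homomorphism of fields). [folklore] -/
theorem map_coordinateRing_ne_zero {r : (W.baseChange (AlgebraicClosure K)).toAffine.CoordinateRing}
    (hr : r ≠ 0) : φc r ≠ 0 := by
  intro h0
  have h := map_algebraMap_coordinateRing W ι φc hφc φ hφ₀ hφx hφy r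
  rw [h0, map_zero, map_eq_zero_iff φ φ.injective,
    map_eq_zero_iff _ (IsFractionRing.injective _ _)] at h
  exact hr h

/-- **The order at `O` is preserved**: `ord_O (ι_* r) = ord_O (r)` for regular `r ≠ 0`
(`ord_O = -deg N`, and `φc` preserves the degree of the norm). [folklore] -/
theorem ord_zero_map_algebraMap {r : (W.baseChange (AlgebraicClosure K)).toAffine.CoordinateRing}
    (hr : r ≠ 0) :
    ord ((W.baseChange E).baseChange (AlgebraicClosure E)).toAffine 0
        (φ (algebraMap _ W.geomFunctionField r)) =
      ord (W.baseChange (AlgebraicClosure K)).toAffine 0 (algebraMap _ W.geomFunctionField r) := by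
  rw [map_algebraMap_coordinateRing W ι φc hφc φ hφ₀ hφx hφy,
    ord_zero_algebraMap (map_coordinateRing_ne_zero W ι φc hφc φ hφ₀ hφx hφy hr),
    ord_zero_algebraMap hr, normDeg_map W ι φc hφc]

variable (θ : WeierstrassCurve.geomPoints W →+ WeierstrassCurve.geomPoints (W.baseChange E))
variable (hθ : ∀ P, θ P = Affine.Point.congrEquiv
  (baseChange_baseChange_algebraicClosure W (E := E)).symm (pointsMapOfEmb W ι P))

include hθ

/-- **The order at an affine point does not drop**: `ord_P (r) ≤ ord_{θ P} (ι_* r)` for regular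
`r ≠ 0` (`r ∈ 𝔪_P^m` gives `φc r ∈ 𝔪_{θP}^m`, `map_pointIdeal_le`; orders at affine points are
read off the adic valuations, Mathlib's `intValuation_le_pow_iff_mem`). [folklore] -/
theorem ord_le_ord_map_algebraMap_some {a b : AlgebraicClosure K}
    (h : (W.baseChange (AlgebraicClosure K)).toAffine.Nonsingular a b)
    {r : (W.baseChange (AlgebraicClosure K)).toAffine.CoordinateRing} (hr : r ≠ 0) :
    ord (W.baseChange (AlgebraicClosure K)).toAffine (.some a b h) (algebraMap _ W.geomFunctionField r) ≤
      ord ((W.baseChange E).baseChange (AlgebraicClosure E)).toAffine (θ (.some a b h))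
        (φ (algebraMap _ W.geomFunctionField r)) := by
  obtain ⟨h', hθP⟩ := theta_some W ι θ hθ h
  rw [hθP, map_algebraMap_coordinateRing W ι φc hφc φ hφ₀ hφx hφy]
  have hr' := map_coordinateRing_ne_zero W ι φc hφc φ hφ₀ hφx hφy hr
  have ha0 : algebraMap _ W.geomFunctionField r ≠ 0 :=
    (map_ne_zero_iff _ (IsFractionRing.injective _ _)).mpr hr
  have ha0' : algebraMap _ (W.baseChange E).geomFunctionField (φc r) ≠ 0 :=
    (map_ne_zero_iff _ (IsFractionRing.injective _ _)).mpr hr'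
  set m := ord (W.baseChange (AlgebraicClosure K)).toAffine (.some a b h)
    (algebraMap _ W.geomFunctionField r) with hm
  set m' := ord ((W.baseChange E).baseChange (AlgebraicClosure E)).toAffine (.some (ι a) (ι b) h')
    (algebraMap _ (W.baseChange E).geomFunctionField (φc r)) with hm'
  -- `m ≥ 0`
  have hv := placeValuation_some_algebraMap_le_one h r
  rw [placeValuation_eq_exp_neg_ord _ ha0, ← hm, ← WithZero.exp_zero, WithZero.exp_le_exp] at hv
  have hm0 : 0 ≤ m := by omega
  -- `r ∈ 𝔪_P ^ m`
  have hmem : r ∈ (pointIdeal (W.baseChange (AlgebraicClosure K)).toAffine a b) ^ m.toNat := by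
    rw [← pointPrime_asIdeal h.left, ← IsDedekindDomain.HeightOneSpectrum.intValuation_le_pow_iff_mem,
      ← IsDedekindDomain.HeightOneSpectrum.valuation_of_algebraMap (K := W.geomFunctionField),
      ← placeValuation_some h, placeValuation_eq_exp_neg_ord _ ha0, ← hm, Int.toNat_of_nonneg hm0]
  -- `φc r ∈ 𝔪_{θP} ^ m`
  have hmem' : φc r ∈ (pointIdeal ((W.baseChange E).baseChange (AlgebraicClosure E)).toAffine
      (ι a) (ι b)) ^ m.toNat := by
    refine Ideal.pow_right_mono (map_pointIdeal_le W ι φc hφc a b) _ ?_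
    rw [← Ideal.map_pow]
    exact Ideal.mem_map_of_mem φc hmem
  rw [← pointPrime_asIdeal h'.left, ← IsDedekindDomain.HeightOneSpectrum.intValuation_le_pow_iff_mem,
    ← IsDedekindDomain.HeightOneSpectrum.valuation_of_algebraMap (K := (W.baseChange E).geomFunctionField),
    ← placeValuation_some h', placeValuation_eq_exp_neg_ord _ ha0', ← hm', WithZero.exp_le_exp,
    Int.toNat_of_nonneg hm0] at hmem'
  omega

/-- **`ι_*` preserves divisors of regular functions**: for `r ∈ K̄[E] ∖ {0}`,
`ord_{θP} (ι_* r) = ord_P (r)` for all `P ∈ E(K̄)` and `ord_R (ι_* r) = 0` for `R` outside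
`θ(E(K̄))` — the degree argument: both divisors have degree `0` (`finsum_ord` over `K̄` and over
`K̄_E`), `ord_{O'} = ord_O` (`ord_zero_map_algebraMap`), no order drops at affine points
(`ord_le_ord_map_algebraMap_some`) and `ι_* r` is regular at the remaining affine points, so all
the inequalities are equalities. Silverman, *AEC*, II.§1–2 (base extension does not change
`ord_P`). [folklore] -/
theorem ord_map_algebraMap {r : (W.baseChange (AlgebraicClosure K)).toAffine.CoordinateRing}
    (hr : r ≠ 0) :
    (∀ P : WeierstrassCurve.geomPoints W,
      ord ((W.baseChange E).baseChange (AlgebraicClosure E)).toAffine (θ P)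
          (φ (algebraMap _ W.geomFunctionField r)) =
        ord (W.baseChange (AlgebraicClosure K)).toAffine P (algebraMap _ W.geomFunctionField r)) ∧
    (∀ R : WeierstrassCurve.geomPoints (W.baseChange E), R ∉ Set.range θ →
      ord ((W.baseChange E).baseChange (AlgebraicClosure E)).toAffine R
        (φ (algebraMap _ W.geomFunctionField r)) = 0) := by
  set w := algebraMap _ W.geomFunctionField r with hw
  set w' := φ w with hw'
  have hw0 : w ≠ 0 := (map_ne_zero_iff _ (IsFractionRing.injective _ _)).mpr hr
  have hw'0 : w' ≠ 0 := (map_ne_zero φ).mpr hw0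
  have hinj := theta_injective W ι θ hθ
  -- pointwise inequalities
  have hge : ∀ P : WeierstrassCurve.geomPoints W,
      ord (W.baseChange (AlgebraicClosure K)).toAffine P w ≤
        ord ((W.baseChange E).baseChange (AlgebraicClosure E)).toAffine (θ P) w' := by
    intro P
    rcases eq_or_ne P 0 with rfl | hP
    · rw [map_zero]
      exact le_of_eq (ord_zero_map_algebraMap W ι φc hφc φ hφ₀ hφx hφy hr).symm
    · obtain ⟨a, b, h, rfl⟩ := geomPoints.exists_eq_some hP
      exact ord_le_ord_map_algebraMap_some W ι φc hφc φ hφ₀ hφx hφy θ hθ h hr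
  have hreg : ∀ R : WeierstrassCurve.geomPoints (W.baseChange E), R ≠ 0 →
      0 ≤ ord ((W.baseChange E).baseChange (AlgebraicClosure E)).toAffine R w' := by
    intro R hR
    obtain ⟨a, b, h, rfl⟩ := geomPoints.exists_eq_some hR
    have hv := placeValuation_some_algebraMap_le_one h (φc r)
    rw [← map_algebraMap_coordinateRing W ι φc hφc φ hφ₀ hφx hφy, ← hw, ← hw',
      placeValuation_eq_exp_neg_ord _ hw'0, ← WithZero.exp_zero, WithZero.exp_le_exp] at hv
    omega
  -- finite supports and the two degree-zero identities
  have hfin₁ := finite_support_ord (V := (W.baseChange (AlgebraicClosure K)).toAffine) hw0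
  have hfin₂ := finite_support_ord (V := ((W.baseChange E).baseChange (AlgebraicClosure E)).toAffine) hw'0
  have hfin₃ : (θ ⁻¹' Function.support fun R ↦
      ord ((W.baseChange E).baseChange (AlgebraicClosure E)).toAffine R w').Finite :=
    hfin₂.preimage hinj.injOn
  let S : Finset (WeierstrassCurve.geomPoints W) := hfin₁.toFinset ∪ hfin₃.toFinset ∪ {0}
  let S' : Finset (WeierstrassCurve.geomPoints (W.baseChange E)) := hfin₂.toFinset ∪ S.image θ
  have hS₁ : ∀ P, P ∉ S → ord (W.baseChange (AlgebraicClosure K)).toAffine P w = 0 := by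
    intro P hP
    by_contra hne
    exact hP (Finset.mem_union_left _ (Finset.mem_union_left _ (hfin₁.mem_toFinset.mpr hne)))
  have hS₃ : ∀ P, P ∉ S → ord ((W.baseChange E).baseChange (AlgebraicClosure E)).toAffine (θ P) w' = 0 := by
    intro P hP
    by_contra hne
    exact hP (Finset.mem_union_left _ (Finset.mem_union_right _ (hfin₃.mem_toFinset.mpr hne)))
  have hS' : ∀ R, R ∉ S' → ord ((W.baseChange E).baseChange (AlgebraicClosure E)).toAffine R w' = 0 := by
    intro R hR
    by_contra hne
    exact hR (Finset.mem_union_left _ (hfin₂.mem_toFinset.mpr hne))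
  have h0S : (0 : WeierstrassCurve.geomPoints W) ∈ S := Finset.mem_union_right _ (Finset.mem_singleton_self _)
  have hsum₁ : ∑ P ∈ S, ord (W.baseChange (AlgebraicClosure K)).toAffine P w = 0 := by
    rw [← finsum_eq_sum_of_support_subset _ (fun P hP ↦ ?_)]
    · exact finsum_ord hw0
    · by_contra hPS
      exact hP (hS₁ P hPS)
  have hsum₂ : ∑ R ∈ S', ord ((W.baseChange E).baseChange (AlgebraicClosure E)).toAffine R w' = 0 := by
    rw [← finsum_eq_sum_of_support_subset _ (fun R hR ↦ ?_)]
    · exact finsum_ord hw'0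
    · by_contra hRS
      exact hR (hS' R hRS)
  have himg : S.image θ ⊆ S' := Finset.subset_union_right
  have hsplit := Finset.sum_sdiff himg
    (f := fun R : WeierstrassCurve.geomPoints (W.baseChange E) ↦
      ord ((W.baseChange E).baseChange (AlgebraicClosure E)).toAffine R w')
  rw [hsum₂, Finset.sum_image (fun x _ y _ hxy ↦ hinj hxy)] at hsplit
  -- nonnegativity of the two pieces
  have hA : ∀ R ∈ S' \ S.image θ,
      0 ≤ ord ((W.baseChange E).baseChange (AlgebraicClosure E)).toAffine R w' := by
    intro R hR
    refine hreg R fun hR0 ↦ ?_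
    rw [Finset.mem_sdiff] at hR
    exact hR.2 (Finset.mem_image.mpr ⟨0, h0S, by rw [map_zero, hR0]⟩)
  have hB : ∀ P ∈ S, 0 ≤ ord ((W.baseChange E).baseChange (AlgebraicClosure E)).toAffine (θ P) w' -
      ord (W.baseChange (AlgebraicClosure K)).toAffine P w := fun P _ ↦ sub_nonneg.mpr (hge P)
  have hAsum := Finset.sum_nonneg hA
  have hBsum := Finset.sum_nonneg hB
  have hBsum' := hBsum
  rw [Finset.sum_sub_distrib, hsum₁, sub_zero] at hBsum'
  obtain ⟨hAzero, hBzero'⟩ := (add_eq_zero_iff_of_nonneg hAsum hBsum').mp hsplit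
  have hBzero : ∑ P ∈ S, (ord ((W.baseChange E).baseChange (AlgebraicClosure E)).toAffine (θ P) w' -
      ord (W.baseChange (AlgebraicClosure K)).toAffine P w) = 0 := by
    rw [Finset.sum_sub_distrib, hsum₁, sub_zero, hBzero']
  rw [Finset.sum_eq_zero_iff_of_nonneg hA] at hAzero
  rw [Finset.sum_eq_zero_iff_of_nonneg hB] at hBzero
  refine ⟨fun P ↦ ?_, fun R hR ↦ ?_⟩
  · by_cases hP : P ∈ S
    · exact sub_eq_zero.mp (hBzero P hP)
    · rw [hS₁ P hP, hS₃ P hP]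
  · by_cases hRS : R ∈ S'
    · refine hAzero R (Finset.mem_sdiff.mpr ⟨hRS, fun himg' ↦ hR ?_⟩)
      obtain ⟨P, -, rfl⟩ := Finset.mem_image.mp himg'
      exact ⟨P, rfl⟩
    · exact hS' R hRS

/-- **`ι_*` preserves divisors**: for `u ∈ K̄(E)^×`, `ord_{θP} (ι_* u) = ord_P (u)` for all
`P ∈ E(K̄)` and `ord_R (ι_* u) = 0` off `θ(E(K̄))` (`ord_map_algebraMap` for numerator and
denominator). [folklore] -/
theorem ord_map {u : W.geomFunctionField} (hu : u ≠ 0) :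
    (∀ P : WeierstrassCurve.geomPoints W,
      ord ((W.baseChange E).baseChange (AlgebraicClosure E)).toAffine (θ P) (φ u) =
        ord (W.baseChange (AlgebraicClosure K)).toAffine P u) ∧
    (∀ R : WeierstrassCurve.geomPoints (W.baseChange E), R ∉ Set.range θ →
      ord ((W.baseChange E).baseChange (AlgebraicClosure E)).toAffine R (φ u) = 0) := by
  obtain ⟨r₁, r₂, hr₂, rfl⟩ := IsFractionRing.div_surjective
    (A := (W.baseChange (AlgebraicClosure K)).toAffine.CoordinateRing) u
  have hr₂' : r₂ ≠ 0 := nonZeroDivisors.ne_zero hr₂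
  have hr₁ : r₁ ≠ 0 := by
    rintro rfl
    simp at hu
  have ha₁ : algebraMap _ W.geomFunctionField r₁ ≠ 0 :=
    (map_ne_zero_iff _ (IsFractionRing.injective _ _)).mpr hr₁
  have ha₂ : algebraMap _ W.geomFunctionField r₂ ≠ 0 :=
    (map_ne_zero_iff _ (IsFractionRing.injective _ _)).mpr hr₂'
  obtain ⟨h₁, h₁'⟩ := ord_map_algebraMap W ι φc hφc φ hφ₀ hφx hφy θ hθ hr₁
  obtain ⟨h₂, h₂'⟩ := ord_map_algebraMap W ι φc hφc φ hφ₀ hφx hφy θ hθ hr₂'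
  refine ⟨fun P ↦ ?_, fun R hR ↦ ?_⟩
  · rw [map_div₀, ord_div _ ((map_ne_zero φ).mpr ha₁) ((map_ne_zero φ).mpr ha₂), ord_div _ ha₁ ha₂,
      h₁, h₂]
  · rw [map_div₀, ord_div _ ((map_ne_zero φ).mpr ha₁) ((map_ne_zero φ).mpr ha₂), h₁' R hR, h₂' R hR,
      sub_zero]

/-- **Transport of a divisor identity along `ι_*`**: if `div u = D` on `E_{K̄}` then
`div (ι_* u) = θ_* D` on `(E_E)_{K̄_E}` (`Finsupp.mapDomain` along the injective `θ`).
[folklore] -/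
theorem ord_map_eq_mapDomain {u : W.geomFunctionField} (hu : u ≠ 0)
    (D : WeierstrassCurve.geomPoints W →₀ ℤ)
    (hD : ∀ P, ord (W.baseChange (AlgebraicClosure K)).toAffine P u = D P)
    (R : WeierstrassCurve.geomPoints (W.baseChange E)) :
    ord ((W.baseChange E).baseChange (AlgebraicClosure E)).toAffine R (φ u) = D.mapDomain θ R := by
  obtain ⟨h₁, h₂⟩ := ord_map W ι φc hφc φ hφ₀ hφx hφy θ hθ hu
  by_cases hR : R ∈ Set.range θ
  · obtain ⟨P, rfl⟩ := hR
    rw [h₁, hD, Finsupp.mapDomain_apply (theta_injective W ι θ hθ)]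
  · rw [h₂ R hR, Finsupp.mapDomain_notin_range _ _ hR]

end CoordinateRing

/-! ### The obstruction is a `2`-cocycle -/

section Cocycle

variable [W.IsElliptic]
variable (c : contOneCocycles (discreteTopRep (Field.absoluteGaloisGroup K) (WeierstrassCurve.geomPoints W)))

/-- **The obstruction values form a `2`-cocycle**: `e(σ,τ) e(στ,υ) = σ(e(τ,υ)) e(σ,τυ)` for
`e(σ,τ) = f_σ ρ_σ(f_τ)/f_{στ}` read in `K̄(E)` (a formal consequence of `ρ_{στ} = ρ_σ ρ_τ` and
`ρ_σ = σ` on constants; it is the standard cocycle of a projective/crossed `1`-cochain).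
[folklore] -/
theorem obstruction_cocycle (f : Field.absoluteGaloisGroup K → W.geomFunctionField) (hf0 : ∀ σ, f σ ≠ 0)
    (e : Field.absoluteGaloisGroup K → Field.absoluteGaloisGroup K → AlgebraicClosure K)
    (he : ∀ σ τ, algebraMap (AlgebraicClosure K) W.geomFunctionField (e σ τ) =
      f σ * W.transAlgHom (-(c.1 σ)) (W.galFunctionField σ (f τ)) / f (σ * τ))
    (σ τ υ : Field.absoluteGaloisGroup K) :
    e σ τ * e (σ * τ) υ = σ • e τ υ * e σ (τ * υ) := by
  apply (algebraMap (AlgebraicClosure K) W.geomFunctionField).injective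
  have hρ0 : ∀ (γ : Field.absoluteGaloisGroup K) (u : W.geomFunctionField), u ≠ 0 →
      W.transAlgHom (-(c.1 γ)) (W.galFunctionField γ u) ≠ 0 := fun γ u hu ↦
    ((twistGal_injective W c γ).ne_iff' (by simp only [map_zero])).mpr hu
  have h1 := hf0 σ
  have h2 := hf0 (σ * τ)
  have h3 := hf0 (σ * τ * υ)
  have h4 := hf0 (τ * υ)
  have h5 := hρ0 σ _ (hf0 τ)
  have h6 := hρ0 σ _ (hρ0 τ _ (hf0 υ))
  have h7 := hρ0 σ _ (hf0 (τ * υ))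
  rw [map_mul, map_mul, ← twistGal_algebraMap W c σ (e τ υ), he, he, he, he, ← mul_assoc σ τ υ,
    twistGal_mul, map_div₀, map_div₀, map_mul, map_mul]
  field_simp

end Cocycle

/-! ### Local triviality of the obstruction -/

section Local

variable (ι : AlgebraicClosure K →ₐ[K] AlgebraicClosure E) [W.IsElliptic]
variable (θ : WeierstrassCurve.geomPoints W →+ WeierstrassCurve.geomPoints (W.baseChange E))
variable (hθ : ∀ P, θ P = Affine.Point.congrEquiv
  (baseChange_baseChange_algebraicClosure W (E := E)).symm (pointsMapOfEmb W ι P))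
variable (φc : (W.baseChange (AlgebraicClosure K)).toAffine.CoordinateRing →+*
  ((W.baseChange E).baseChange (AlgebraicClosure E)).toAffine.CoordinateRing)
variable (hφc : ∀ p : (AlgebraicClosure K)[X][Y], φc (AdjoinRoot.mk _ p) =
  AdjoinRoot.mk _ (p.map (mapRingHom (ι : AlgebraicClosure K →+* AlgebraicClosure E))))
variable (φ : W.geomFunctionField →+* (W.baseChange E).geomFunctionField)
variable (hφ₀ : ∀ a : AlgebraicClosure K, φ (algebraMap (AlgebraicClosure K) W.geomFunctionField a) =
  algebraMap (AlgebraicClosure E) (W.baseChange E).geomFunctionField (ι a))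
variable (hφx : φ W.genX = (W.baseChange E).genX) (hφy : φ W.genY = (W.baseChange E).genY)
variable (c : contOneCocycles (discreteTopRep (Field.absoluteGaloisGroup K) (WeierstrassCurve.geomPoints W)))

include hθ hφc hφ₀ hφx hφy

/-- **The obstruction of a class dies where the class dies.** Let `c : Γ_K → E(K̄)` be a
continuous cocycle whose class lies in the kernel of the restriction to `H¹(E, E)` along the
`K`-embedding `ι : K̄ → K̄_E` (`WeierstrassCurve.localRestrictionKerOfEmb`; for a number field
and `E = K_v` this is the local condition defining `Ш`), `n·(T)` a rational divisor class on its
torsor, `f_σ` admissible functions (`div f_σ = n(σ⋆T) - n(T)`, locally constant) and `e` the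
obstruction cocycle (`algebraMap (e σ τ) = f_σ ρ_σ(f_τ)/f_{στ}`). Then the restriction of `e` to
`Γ_E`, pushed into `K̄_E` by `ι`, is the coboundary of a locally constant `b : Γ_E → K̄_E^×`.
Proof: transport everything along `ι_*` (`theta_smul`, `map_twistGal`, `ord_map_eq_mapDomain`):
`ι(e(σ|K̄, τ|K̄))` is the obstruction cocycle, over the base field `E`, of the pulled-back cocycle
`c_E = θ ∘ c ∘ res` with the data `θ T`, `ι_* ∘ f ∘ res`; and `c_E` is principal, so
`exists_obstruction_eq_coboundary_of_principal` applies. This is "`V(K_v) ≠ ∅` implies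
`δ ≡ 0` over `K_v`" in Clark 2006, Prop. 6 (second proof), i.e. property b) of O'Neil's
obstruction map (first proof). [cite: Clark2006Crelle, Prop. 6] -/
theorem exists_local_coboundary_of_mem_localRestrictionKerOfEmb
    (hc : oneCocycleClass _ c ∈ W.localRestrictionKerOfEmb ι) {n : ℤ}
    (T : WeierstrassCurve.geomPoints W)
    (hT : ∀ σ : Field.absoluteGaloisGroup K, n • (σ • T + c.1 σ - T) = 0)
    (f : Field.absoluteGaloisGroup K → W.geomFunctionField) (hfc : IsLocallyConstant f)
    (hf0 : ∀ σ, f σ ≠ 0)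
    (hford : ∀ σ P, ord (W.baseChange (AlgebraicClosure K)).toAffine P (f σ) =
      (Finsupp.single (σ • T + c.1 σ) n - Finsupp.single T n) P)
    (e : Field.absoluteGaloisGroup K → Field.absoluteGaloisGroup K → AlgebraicClosure K)
    (he : ∀ σ τ, algebraMap (AlgebraicClosure K) W.geomFunctionField (e σ τ) =
      f σ * W.transAlgHom (-(c.1 σ)) (W.galFunctionField σ (f τ)) / f (σ * τ)) :
    ∃ b : Field.absoluteGaloisGroup E → AlgebraicClosure E, IsLocallyConstant b ∧ (∀ x, b x ≠ 0) ∧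
      ∀ x y, ι (e (resGalOfEmb ι x) (resGalOfEmb ι y)) =
        b x * (show AlgebraicClosure E ≃ₐ[E] AlgebraicClosure E from x) (b y) / b (x * y) := by
  -- the local point splitting `c`
  have hc' : oneCocycleClass _ c ∈ resKer (resGalOfEmb ι) (pointsMapOfEmb W ι)
      (pointsMapOfEmb_smul W ι) := hc
  rw [oneCocycleClass_mem_resKer_iff] at hc'
  obtain ⟨a, ha⟩ := hc'
  set Q : WeierstrassCurve.geomPoints (W.baseChange E) :=
    Affine.Point.congrEquiv (baseChange_baseChange_algebraicClosure W (E := E)).symm a with hQdef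
  have hQ : ∀ x : Field.absoluteGaloisGroup E, θ (c.1 (resGalOfEmb ι x)) = x • Q - Q := by
    intro x
    rw [hθ, ha]
    refine (map_sub (Affine.Point.congrEquiv _) (x • a) a).trans ?_
    exact congrArg₂ (· - ·) (congrEquiv_symm_smul W x a) rfl
  -- the pulled-back cocycle `c_E = θ ∘ c ∘ res`
  let cE : contOneCocycles (discreteTopRep (Field.absoluteGaloisGroup E)
      (WeierstrassCurve.geomPoints (W.baseChange E))) :=
    contOneCocycles.pullback (resGalOfEmb ι)
      (resHomOfEquivariant (resGalOfEmb ι) θ (theta_smul W ι θ hθ)) c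
  have hcE : ∀ x, cE.1 x = θ (c.1 (resGalOfEmb ι x)) := fun _ ↦ rfl
  have hcEQ : ∀ x, cE.1 x = x • Q - Q := fun x ↦ by rw [hcE, hQ]
  -- the transported data
  have hT' : ∀ x : Field.absoluteGaloisGroup E, n • (x • θ T + cE.1 x - θ T) = 0 := fun x ↦ by
    rw [hcE, ← theta_smul W ι θ hθ, ← map_add, ← map_sub, ← map_zsmul, hT, map_zero]
  set f' : Field.absoluteGaloisGroup E → (W.baseChange E).geomFunctionField :=
    fun x ↦ φ (f (resGalOfEmb ι x)) with hf'
  have hf'c : IsLocallyConstant f' :=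
    (hfc.comp_continuous (map_continuous (resGalOfEmb ι))).comp φ
  have hf'0 : ∀ x, f' x ≠ 0 := fun x ↦ (map_ne_zero φ).mpr (hf0 _)
  have hf'ord : ∀ x R, ord ((W.baseChange E).baseChange (AlgebraicClosure E)).toAffine R (f' x) =
      (Finsupp.single (x • θ T + cE.1 x) n - Finsupp.single (θ T) n) R := by
    intro x R
    rw [hf', ord_map_eq_mapDomain W ι φc hφc φ hφ₀ hφx hφy θ hθ (hf0 _) _ (hford _) R]
    congr 1
    change Finsupp.mapDomain.addMonoidHom θ _ = _
    rw [map_sub, Finsupp.mapDomain.addMonoidHom_apply, Finsupp.mapDomain.addMonoidHom_apply,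
      Finsupp.mapDomain_single, Finsupp.mapDomain_single, map_add, theta_smul W ι θ hθ, hcE]
  -- the local obstruction is a coboundary
  obtain ⟨b, hbc, hb0, hb⟩ := exists_obstruction_eq_coboundary_of_principal (W.baseChange E) cE Q
    hcEQ (θ T) hT' f' hf'c hf'0 hf'ord
  refine ⟨b, hbc, hb0, fun x y ↦ ?_⟩
  apply (algebraMap (AlgebraicClosure E) (W.baseChange E).geomFunctionField).injective
  have h := hb x y
  rw [hcE] at h
  simp only [hf'] at h
  rw [map_mul (resGalOfEmb ι), ← map_twistGal W ι θ hθ φ hφ₀ hφx hφy c, ← map_mul, ← map_div₀,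
    ← he, hφ₀] at h
  exact h

end Local

/-! ### Cassels' theorem from the Hasse principle for `H²(K, K̄^×)` -/

section NumberField

open NumberField IsDedekindDomain

/-- **Local triviality at a completion** (`exists_local_coboundary_of_mem_localRestrictionKerOfEmb`
for the chosen embedding `closureEmb E` and restriction `resGal E` of the file `Sha`, with the
base-change maps `ι_*` on points, regular functions and rational functions supplied by
`exists_ringHom_coordinateRing_baseChange`, `exists_ringHom_geomFunctionField_baseChange`).
[cite: Clark2006Crelle, Prop. 6] -/
theorem exists_local_coboundary_of_mem_localRestrictionKer [W.IsElliptic] (E : Type u) [Field E]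
    [Algebra K E]
    (c : contOneCocycles (discreteTopRep (Field.absoluteGaloisGroup K) (WeierstrassCurve.geomPoints W)))
    (hc : oneCocycleClass _ c ∈ W.localRestrictionKer E) {n : ℤ}
    (T : WeierstrassCurve.geomPoints W)
    (hT : ∀ σ : Field.absoluteGaloisGroup K, n • (σ • T + c.1 σ - T) = 0)
    (f : Field.absoluteGaloisGroup K → W.geomFunctionField) (hfc : IsLocallyConstant f)
    (hf0 : ∀ σ, f σ ≠ 0)
    (hford : ∀ σ P, ord (W.baseChange (AlgebraicClosure K)).toAffine P (f σ) =
      (Finsupp.single (σ • T + c.1 σ) n - Finsupp.single T n) P)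
    (e : Field.absoluteGaloisGroup K → Field.absoluteGaloisGroup K → AlgebraicClosure K)
    (he : ∀ σ τ, algebraMap (AlgebraicClosure K) W.geomFunctionField (e σ τ) =
      f σ * W.transAlgHom (-(c.1 σ)) (W.galFunctionField σ (f τ)) / f (σ * τ)) :
    ∃ b : Field.absoluteGaloisGroup E → AlgebraicClosure E, IsLocallyConstant b ∧ (∀ x, b x ≠ 0) ∧
      ∀ x y, closureEmb (K := K) E (e (resGal (K := K) E x) (resGal (K := K) E y)) =
        b x * x • b y / b (x * y) := by
  obtain ⟨φ, hφ₀, hφx, hφy⟩ := exists_ringHom_geomFunctionField_baseChange W (E := E) (closureEmb E)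
  obtain ⟨φc, hφc⟩ := exists_ringHom_coordinateRing_baseChange W (E := E) (closureEmb E)
  exact exists_local_coboundary_of_mem_localRestrictionKerOfEmb W (closureEmb E)
    ((Affine.Point.congrEquiv (baseChange_baseChange_algebraicClosure W (E := E)).symm).toAddMonoidHom.comp
      (pointsMapOfEmb W (closureEmb E)))
    (fun _ ↦ rfl) φc hφc φ hφ₀ hφx hφy c hc T hT f hfc hf0 hford e he

/-- **Cassels' `I = P` on `Ш` from the Hasse principle for `H²(K, K̄^×)`.** The named fact
`Literature.NumberTheory.EllipticCurves.Cassels1962_index_eq_period_of_mem_sha` (Cassels 1962: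
for an elliptic curve `E` over a number field `K` and `η ∈ Ш(E/K)`, index = period) follows from
the **Hasse principle for the Brauer group**, in the cochain form: *for every number field `K`,
every locally constant `2`-cocycle `e : Γ_K × Γ_K → K̄^×` whose restriction to `Γ_{K_v}` (pushed
into `K̄_v^×` along the chosen embedding) is a continuous coboundary for every finite place `v`
and every infinite place `w` is itself a continuous coboundary* — the injectivity of
`Br(K) = H²(K, K̄^×) → ∏_v Br(K_v)` (Albert–Brauer–Hasse–Noether; Harari Thm. 14.11), "the
reciprocity law in the Brauer group of a number field" invoked by both printed proofs
(Clark 2006, Prop. 6). Everything else is proved in the tree: the reduction to Selmer classes of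
prime-power level (`PeriodIndexCassels`), rational divisors bound the index
(`PeriodIndexRationalDivisor`), the obstruction theory (`PeriodIndexObstruction`: twisted Hilbert
90, `e = ∂b ⇒ I ∣ n`), continuity and the cocycle identity of `e`, and its local triviality at
every place where the class dies (`exists_local_coboundary_of_mem_localRestrictionKer`, this
file), which for a Selmer class is every place (Silverman X.4.2(a)). The hypothesis is spelled
out, not vendored as a named fact (D-0026). [cite: Clark2006Crelle, Prop. 6 with Prop. 5(a)]
[cite: ClarkSharif2010, §3.7 (ii)] -/
theorem Cassels1962_index_eq_period_of_mem_sha_of_hassePrinciple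
    (hp : ∀ {K : Type u} [Field K] [NumberField K]
      (e : Field.absoluteGaloisGroup K → Field.absoluteGaloisGroup K → AlgebraicClosure K),
      IsLocallyConstant (fun p : Field.absoluteGaloisGroup K × Field.absoluteGaloisGroup K ↦ e p.1 p.2) →
      (∀ σ τ, e σ τ ≠ 0) →
      (∀ σ τ υ, e σ τ * e (σ * τ) υ = σ • e τ υ * e σ (τ * υ)) →
      (∀ v : HeightOneSpectrum (𝓞 K),
        ∃ b : Field.absoluteGaloisGroup (v.adicCompletion K) → AlgebraicClosure (v.adicCompletion K),
          IsLocallyConstant b ∧ (∀ x, b x ≠ 0) ∧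
            ∀ x y, closureEmb (K := K) (v.adicCompletion K)
                (e (resGal (K := K) (v.adicCompletion K) x) (resGal (K := K) (v.adicCompletion K) y)) =
              b x * x • b y / b (x * y)) →
      (∀ w : InfinitePlace K,
        ∃ b : Field.absoluteGaloisGroup w.Completion → AlgebraicClosure w.Completion,
          IsLocallyConstant b ∧ (∀ x, b x ≠ 0) ∧
            ∀ x y, closureEmb (K := K) w.Completion
                (e (resGal (K := K) w.Completion x) (resGal (K := K) w.Completion y)) =
              b x * x • b y / b (x * y)) →
      ∃ b : Field.absoluteGaloisGroup K → AlgebraicClosure K, IsLocallyConstant b ∧ (∀ σ, b σ ≠ 0) ∧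
        ∀ σ τ, e σ τ = b σ * σ • b τ / b (σ * τ)) :
    Cassels1962_index_eq_period_of_mem_sha.{u} := by
  refine Cassels1962_index_eq_period_of_mem_sha_of_obstruction
    fun W _ n hn ξ hξ c T f hc hT hfc hf0 hford ↦ ?_
  -- the obstruction values `e(σ, τ) ∈ K̄^×`
  have hex := fun σ τ ↦ exists_obstruction_eq_algebraMap W c T f hf0 hford σ τ
  choose e he0 he using hex
  -- the class lies in `Ш`
  have hn0 : (n : ℤ) ≠ 0 := by exact_mod_cast hn.pos.ne'
  have hsha : oneCocycleClass _ c ∈ W.sha := by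
    rw [hc]
    exact torsionH1ToH1_mem_sha_of_mem_selmerGroup W hn0 hξ
  rw [WeierstrassCurve.mem_sha_iff] at hsha
  obtain ⟨b, hbc, hb0, hb⟩ := hp e (isLocallyConstant_obstruction W c f hfc e he) he0
    (obstruction_cocycle W c f hf0 e he)
    (fun v ↦ exists_local_coboundary_of_mem_localRestrictionKer W _ c (hsha.1 v) T hT f hfc hf0
      hford e he)
    (fun w ↦ exists_local_coboundary_of_mem_localRestrictionKer W _ c (hsha.2 w) T hT f hfc hf0
      hford e he)
  refine ⟨b, hbc, hb0, fun σ τ ↦ ?_⟩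
  rw [← he, hb]

end NumberField

end Literature.NumberTheory.EllipticCurves
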